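import Literature.NumberTheory.GaloisRepresentations.HomDualPresentation
import Literature.NumberTheory.GaloisRepresentations.SpectralOrdQ
import HarnessLib

/-!
# Unit-valued EXTENSIONS: correcting an equivariant `e : P → k̄ˣ` by the monomial `ϖ^{ord ∘ e}` so that it
# becomes unit-valued, without changing it on a submodule where it already is (valuation splitting for extensions)

Topic `NumberTheory/GaloisRepresentations`; namespace `Literature.NumberTheory.GaloisRepresentations.HomDual`.
One auxiliary definition with body (`intOrdHom`, the integer-valued valuation of an integrally valued
homomorphism) and theorems; no named fact, no instance, no notation, no `sorry`.  Companion of door-c6 g16's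
`HomDualValuationSplitting` (`exists_unitValued_dualδ₀_eq`: correct `h : N₁ → k̄ˣ` keeping `δ₀ h`); here the
roles are reversed — the EXTENSION is corrected, its restriction is kept.

THE MATHEMATICS (the unit refinement at `v ∉ T` in Milne's proof of *ADT* I Lemma 4.13, for the relation
module of a LATTICE rather than of a torsion module).  Let `k` be a nonarchimedean local field,
`ord : k̄ˣ → ℚ` its normalised `Γ_k`-invariant valuation (`IsNonarchimedeanLocalField.ordQ`, `ord ϖ = 1` for a
uniformiser `ϖ ∈ k`), `P` a discrete `Γ_k`-module, `i : X → P` any additive map and `e : P → k̄ˣ` a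
`Γ_k`-EQUIVARIANT homomorphism such that
(i) `ord (e (i x)) = 0` for all `x` (unit-valued on the image of `i`), and
(ii) `ord (e p) ∈ ℤ` for all `p` (intended: the values of `e` lie in an unramified extension of `k`).
Then `ν := ord ∘ e : P → ℤ` is an additive, `Γ_k`-INVARIANT integer-valued map vanishing on `i(X)`, the monomial
homomorphism `t := ν • ϖ : p ↦ ϖ^{ν p}` is `Γ_k`-equivariant (its values lie in `kˣ`), vanishes on `i(X)`, and
**`e' := e − t` is an equivariant homomorphism with `e' ∘ i = e ∘ i` and `ord (e' p) = 0` for every `p`**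
(`exists_unitValued_extension`).  No basis of `P` is needed.

USE (this seat, `IdeleExtensionLocalGlobal`): with `k = K_v`, `P = P₁|_v` a cover of a lattice trivialised by a
layer unramified at `v`, the local equivariant extensions `e_v` of a unit-valued `X₂ → K̄_vˣ` can be chosen
unit-valued at almost every place, so that door-c5 g17's idèle ASSEMBLY applies to the family `(e_v)_v`.
HONEST FRAMING: local algebra only; no case of Poitou–Tate or BSD is proved here.

## References
* J. S. Milne, *Arithmetic Duality Theorems* (2nd ed. 2006), I Lemma 4.13 (proof: the factor at `v ∉ T`).
  [MilneADT2006]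
* J.-P. Serre, *Local Fields*, GTM 67 (1979), II §2–§3 (valuations, uniformisers). [SerreLocalFields1979]
-/

noncomputable section

namespace Literature.NumberTheory.GaloisRepresentations

namespace HomDual

open Literature.Algebra.Homology Literature.Algebra.Homology.DiscreteRep ContRepresentation Field
  DiscreteGaloisModule IsNonarchimedeanLocalField

variable {k : Type} [Field k] [ValuativeRel k] [TopologicalSpace k] [IsNonarchimedeanLocalField k]
variable {X VP : Type} [AddCommGroup X]
  [AddCommGroup VP] [TopologicalSpace VP] [DiscreteTopology VP] [Module.Finite ℤ VP]
variable {ρP : DiscreteGaloisModule k VP}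

/-! ## §1 The integer-valued valuation `ν = ord ∘ e` of an integrally valued homomorphism -/

section IntOrd

variable (e : VP →ₗ[ℤ] UnitsCarrier k) (hint : ∀ p : VP, ∃ m : ℤ, (m : ℚ) = ordQ k (e p))

/-- **`ν = ord ∘ e : P → ℤ`** for a homomorphism `e : P → k̄ˣ` whose values have integral valuation
(additive because `ord ∘ e` is and `ℤ → ℚ` is injective). [cite: SerreLocalFields1979, II §2] -/
def intOrdHom : VP →+ ℤ where
  toFun p := Classical.choose (hint p)
  map_zero' := Int.cast_injective (α := ℚ) (by
    rw [Classical.choose_spec (hint 0), map_zero, map_zero, Int.cast_zero])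
  map_add' p q := Int.cast_injective (α := ℚ) (by
    rw [Classical.choose_spec (hint (p + q)), map_add, map_add, Int.cast_add, Classical.choose_spec (hint p),
      Classical.choose_spec (hint q)])

omit [TopologicalSpace VP] [DiscreteTopology VP] [Module.Finite ℤ VP] in
/-- `(ν p : ℚ) = ord (e p)`. [cite: SerreLocalFields1979, II §2] -/
@[simp] theorem intOrdHom_cast (p : VP) : ((intOrdHom e hint p : ℤ) : ℚ) = ordQ k (e p) :=
  Classical.choose_spec (hint p)

omit [TopologicalSpace VP] [DiscreteTopology VP] [Module.Finite ℤ VP] in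
/-- `ν p = 0` iff `ord (e p) = 0`. [cite: SerreLocalFields1979, II §2] -/
theorem intOrdHom_eq_zero_iff (p : VP) : intOrdHom e hint p = 0 ↔ ordQ k (e p) = 0 := by
  rw [← intOrdHom_cast e hint p, Int.cast_eq_zero]

omit [Module.Finite ℤ VP] in
/-- **`ν` is `Γ_k`-invariant when `e` is equivariant** (`ord` is `Γ_k`-invariant, `ordQ_smul`).
[cite: MilneADT2006, I Lemma 4.13 (proof)] -/
theorem intOrdHom_smul (he : ∀ (σ : absoluteGaloisGroup k) (p : VP), e (ρP σ p) = units k σ (e p))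
    (σ : absoluteGaloisGroup k) (p : VP) : intOrdHom e hint (ρP σ p) = intOrdHom e hint p :=
  Int.cast_injective (α := ℚ) (by rw [intOrdHom_cast, intOrdHom_cast, he, ordQ_smul])

end IntOrd

/-! ## §2 The monomial correction `t = ν • ϖ` and the unit-valued extension `e' = e − t` -/

section Correction

variable (e : VP →ₗ[ℤ] UnitsCarrier k) (hint : ∀ p : VP, ∃ m : ℤ, (m : ℚ) = ordQ k (e p)) (ϖ : UnitsCarrier k)

/-- **The monomial homomorphism `t : p ↦ ϖ^{ν p}`** (additive notation `ν p • ϖ`), `ν = ord ∘ e`.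
[cite: MilneADT2006, I Lemma 4.13 (proof)] -/
def monomialOfOrd : VP →ₗ[ℤ] UnitsCarrier k :=
  (intOrdHom e hint).toIntLinearMap.smulRight ϖ

omit [TopologicalSpace VP] [DiscreteTopology VP] [Module.Finite ℤ VP] in
/-- Unfolding: `t p = ν p • ϖ`. [cite: MilneADT2006, I Lemma 4.13 (proof)] -/
@[simp] theorem monomialOfOrd_apply (p : VP) : monomialOfOrd e hint ϖ p = intOrdHom e hint p • ϖ := rfl

omit [TopologicalSpace VP] [DiscreteTopology VP] [Module.Finite ℤ VP] in
/-- `ord (t p) = ord (e p)` when `ord ϖ = 1`. [cite: SerreLocalFields1979, II §3] -/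
theorem ordQ_monomialOfOrd (hϖ : ordQ k ϖ = 1) (p : VP) : ordQ k (monomialOfOrd e hint ϖ p) = ordQ k (e p) := by
  rw [monomialOfOrd_apply, map_zsmul, hϖ, zsmul_eq_mul, mul_one, intOrdHom_cast]

omit [TopologicalSpace VP] [DiscreteTopology VP] [Module.Finite ℤ VP] in
/-- `t p = 0` whenever `ord (e p) = 0`. [cite: SerreLocalFields1979, II §2] -/
theorem monomialOfOrd_eq_zero_of_ordQ_eq_zero {p : VP} (hp : ordQ k (e p) = 0) : monomialOfOrd e hint ϖ p = 0 := by
  rw [monomialOfOrd_apply, (intOrdHom_eq_zero_iff e hint p).2 hp, zero_smul]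

omit [Module.Finite ℤ VP] in
/-- **`t` is `Γ_k`-equivariant** when `e` is equivariant and `ϖ` is `Γ_k`-fixed (its values `ϖ^{ν p}` lie in `kˣ`).
[cite: MilneADT2006, I Lemma 4.13 (proof)] -/
theorem monomialOfOrd_smul (he : ∀ (σ : absoluteGaloisGroup k) (p : VP), e (ρP σ p) = units k σ (e p))
    (hϖΓ : ∀ σ : absoluteGaloisGroup k, units k σ ϖ = ϖ) (σ : absoluteGaloisGroup k) (p : VP) :
    monomialOfOrd e hint ϖ (ρP σ p) = units k σ (monomialOfOrd e hint ϖ p) := by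
  rw [monomialOfOrd_apply, monomialOfOrd_apply, intOrdHom_smul e hint he, map_zsmul, hϖΓ]

/-- **Valuation splitting for extensions.**  Let `e : P → k̄ˣ` be a `Γ_k`-equivariant homomorphism out of a
discrete `Γ_k`-module whose values have integral valuation, and `i : X → P` an additive map such that `e` is
unit-valued on `i(X)`.  Then there is an equivariant `e' : P → k̄ˣ` (an invariant of `Hom_ℤ(P, k̄ˣ)`) which agrees
with `e` on `i(X)` and is unit-valued EVERYWHERE: `e' = e − ϖ^{ord ∘ e}` for a uniformiser `ϖ` of `k`
(`exists_ordQ_eq_one`). [cite: MilneADT2006, I Lemma 4.13 (proof)] [cite: SerreLocalFields1979, II §3] -/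
theorem exists_unitValued_extension (i : X →+ VP)
    (he : ∀ (σ : absoluteGaloisGroup k) (p : VP), e (ρP σ p) = units k σ (e p))
    (hunit : ∀ x : X, ordQ k (e (i x)) = 0) (hint : ∀ p : VP, ∃ m : ℤ, (m : ℚ) = ordQ k (e p)) :
    ∃ e' : (homGaloisModule ρP (units k)).toTopRep.ρ.invariants,
      (∀ x : X, (show VP →ₗ[ℤ] UnitsCarrier k from (e'.1 : DiscreteRep.HomCarrier VP (UnitsCarrier k))) (i x) =
        e (i x)) ∧
      ∀ p : VP, ordQ k ((show VP →ₗ[ℤ] UnitsCarrier k from (e'.1 : DiscreteRep.HomCarrier VP (UnitsCarrier k))) p) = 0 := by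
  obtain ⟨ϖ, hϖΓ, hϖ⟩ := exists_ordQ_eq_one k
  refine ⟨invariantOfEquivariant ρP (units k) (e - monomialOfOrd e hint ϖ) (fun σ p => ?_), fun x => ?_, fun p => ?_⟩
  · rw [LinearMap.sub_apply, LinearMap.sub_apply, he, monomialOfOrd_smul e hint ϖ he hϖΓ, map_sub]
  · change (e - monomialOfOrd e hint ϖ) (i x) = e (i x)
    rw [LinearMap.sub_apply, monomialOfOrd_eq_zero_of_ordQ_eq_zero e hint ϖ (hunit x), sub_zero]
  · change ordQ k ((e - monomialOfOrd e hint ϖ) p) = 0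
    rw [LinearMap.sub_apply, map_sub, ordQ_monomialOfOrd e hint ϖ hϖ, sub_self]

/-- The same for an equivariant `e` given as an INVARIANT of `Hom_ℤ(P, k̄ˣ)`, with the unit conclusion in terms
of absolute values `‖e' p‖ = 1` (`ordQ_eq_zero_iff`). [cite: MilneADT2006, I Lemma 4.13 (proof)] -/
theorem exists_algNorm_eq_one_extension (i : X →+ VP) (e : (homGaloisModule ρP (units k)).toTopRep.ρ.invariants)
    (hunit : ∀ x : X, ordQ k ((show VP →ₗ[ℤ] UnitsCarrier k from
      (e.1 : DiscreteRep.HomCarrier VP (UnitsCarrier k))) (i x)) = 0)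
    (hint : ∀ p : VP, ∃ m : ℤ, (m : ℚ) = ordQ k ((show VP →ₗ[ℤ] UnitsCarrier k from
      (e.1 : DiscreteRep.HomCarrier VP (UnitsCarrier k))) p)) :
    ∃ e' : (homGaloisModule ρP (units k)).toTopRep.ρ.invariants,
      (∀ x : X, (show VP →ₗ[ℤ] UnitsCarrier k from (e'.1 : DiscreteRep.HomCarrier VP (UnitsCarrier k))) (i x) =
        (show VP →ₗ[ℤ] UnitsCarrier k from (e.1 : DiscreteRep.HomCarrier VP (UnitsCarrier k))) (i x)) ∧
      ∀ p : VP, algNorm k (unitsVal k ((show VP →ₗ[ℤ] UnitsCarrier k from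
        (e'.1 : DiscreteRep.HomCarrier VP (UnitsCarrier k))) p) : AlgebraicClosure k) = 1 := by
  obtain ⟨e', h1, h2⟩ := exists_unitValued_extension (ρP := ρP)
    (show VP →ₗ[ℤ] UnitsCarrier k from (e.1 : DiscreteRep.HomCarrier VP (UnitsCarrier k))) i
    ((mem_invariants_iff ρP (units k) e.1).1 e.2) hunit hint
  exact ⟨e', h1, fun p => (ordQ_eq_zero_iff k _).1 (h2 p)⟩

end Correction

end HomDual

end Literature.NumberTheory.GaloisRepresentations

end
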